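import Mathlib

/-!
# Cyclotomic translation schemes, I: multiplicative character sums (solo-informed dossier, gen 103)

Solo-informed seat (MatrixMultiplication); dossier `paper/theoremB2.md` §6, `sharpest-statement.md` §2y(9).
Toolkit for THEOREM C1 (file `SoloInformedCyclotomicSchemes`): for a finite field `F` and the characters
`χ : MulChar F ℂ` — dual orthogonality `Σ_χ χ(a) = (q-1)[a = 1]` (from Mathlib's
`MulChar.exists_apply_ne_one_of_hasEnoughRootsOfUnity`), the transform `ft A χ = Σ_{a∈A} χ(a)` of a set
of units with its indicator expansion and Parseval identity, the Jacobi-type sum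
`K(χ₁,χ₂) = Σ_x χ₁(x)χ₂(-(1+x)) = χ₁(-1)χ₂(-1)·J(χ₁,χ₂)` with `‖K‖ ≤ √q` off the principal pair
(Mathlib `jacobiSum_mul_jacobiSum_inv`, `jacobiSum_one_nontrivial`, `jacobiSum_nontrivial_inv`), the
MAIN IDENTITY `Σ_{χ₁,χ₂} conj B̂(χ₁)·conj Ĉ(χ₂)·Â(χ₁χ₂)·K(χ₁,χ₂) = 0` for a triple `A, B, C ⊆ Fˣ` without
solutions of `a + b + c = 0`, the vanishing of `Â` off the annihilator of a subgroup `H ≤ Fˣ` stabilising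
`A`, and `#{χ : χ|_H = 1}·|H| = q - 1` (Mathlib `MulChar.card_subgroupOrderIsoSubgroupMulChar`).
All statements are folklore; references: Cohn–Umans 2013 (arXiv:1207.6528) Def. 11/12 for the use.
-/

noncomputable section

open Finset MulChar

namespace Summit.MatrixMultiplication.MatrixMultiplication.Theorems.Cyclotomic

variable {F : Type*} [Field F] [Fintype F] [DecidableEq F]

/-! ### 1. The transform of a set of units and the Jacobi-type sum `K` -/

omit [DecidableEq F] in
/-- A finite field has at least one element. -/
theorem one_le_card : 1 ≤ Fintype.card F := Fintype.card_pos

omit [DecidableEq F] in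
/-- `((q - 1 : ℕ) : ℂ) = q - 1`. -/
theorem cast_card_sub_one : ((Fintype.card F - 1 : ℕ) : ℂ) = (Fintype.card F : ℂ) - 1 := by
  rw [Nat.cast_sub one_le_card, Nat.cast_one]

omit [Fintype F] [DecidableEq F] in
/-- `ft A χ = Σ_{a ∈ A} χ(a)`, the multiplicative Fourier transform of a set of units. -/
def ft (A : Finset Fˣ) (χ : MulChar F ℂ) : ℂ := ∑ a ∈ A, χ (a : F)

omit [Fintype F] [DecidableEq F] in
/-- The transform at the trivial character is the cardinality. -/
theorem ft_one (A : Finset Fˣ) : ft A (1 : MulChar F ℂ) = A.card := by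
  simp [ft, MulChar.one_apply_coe]

omit [DecidableEq F] in
/-- `conj (ft A χ) = Σ_{a∈A} χ(a⁻¹)`. -/
theorem star_ft (A : Finset Fˣ) (χ : MulChar F ℂ) :
    starRingEnd ℂ (ft A χ) = ∑ a ∈ A, χ ((a⁻¹ : Fˣ) : F) := by
  simp only [ft, map_sum, starRingEnd_apply, MulChar.star_apply', MulChar.inv_apply',
    Units.val_inv_eq_inv_val]

omit [Fintype F] [DecidableEq F] in
/-- `H`-stability kills the transform off the annihilator of `H`. -/
theorem ft_eq_zero_of_apply_ne_one (H : Subgroup Fˣ) (A : Finset Fˣ)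
    (hA : ∀ u ∈ H, ∀ a ∈ A, u * a ∈ A) {χ : MulChar F ℂ} {u : Fˣ} (hu : u ∈ H)
    (hχu : χ (u : F) ≠ 1) : ft A χ = 0 := by
  classical
  have himage : A.image (fun a => u * a) = A := by
    apply Finset.eq_of_subset_of_card_le
    · intro x hx
      obtain ⟨a, ha, rfl⟩ := Finset.mem_image.mp hx
      exact hA u hu a ha
    · rw [Finset.card_image_of_injective _ (mul_right_injective u)]
  have h1 : ft A χ = χ u * ft A χ := by
    conv_lhs => rw [ft, ← himage, Finset.sum_image (fun a _ b _ h => mul_right_injective u h)]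
    simp only [ft, Units.val_mul, map_mul, Finset.mul_sum]
  have h2 : (χ u - 1) * ft A χ = 0 := by rw [sub_mul, one_mul, ← h1, sub_self]
  rcases mul_eq_zero.mp h2 with h | h
  · exact absurd (sub_eq_zero.mp h) hχu
  · exact h

omit [DecidableEq F] in
/-- `K χ₁ χ₂ = Σ_{x ∈ F} χ₁(x)·χ₂(-(1+x))`. -/
def K (χ₁ χ₂ : MulChar F ℂ) : ℂ := ∑ x : F, χ₁ x * χ₂ (-(1 + x))

omit [DecidableEq F] in
/-- `K(χ₁,χ₂) = χ₁(-1)·χ₂(-1)·J(χ₁,χ₂)` (substitute `x ↦ -x`). -/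
theorem K_eq (χ₁ χ₂ : MulChar F ℂ) : K χ₁ χ₂ = χ₁ (-1) * χ₂ (-1) * jacobiSum χ₁ χ₂ := by
  unfold K jacobiSum
  rw [Finset.mul_sum]
  refine Fintype.sum_equiv (Equiv.neg F) _ _ fun x => ?_
  simp only [Equiv.neg_apply, sub_neg_eq_add]
  rw [show χ₁ x = χ₁ (-1) * χ₁ (-x) by rw [← map_mul]; congr 1; ring,
    show χ₂ (-(1 + x)) = χ₂ (-1) * χ₂ (1 + x) by rw [← map_mul]; congr 1; ring]
  ring

omit [DecidableEq F] in
/-- `Σ_y χ₁(y)χ₂(-(a+y)) = χ₁(a)χ₂(a)·K(χ₁,χ₂)` for a unit `a` (substitute `y = a·x`). -/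
theorem inner_sum_eq (a : Fˣ) (χ₁ χ₂ : MulChar F ℂ) :
    ∑ y : F, χ₁ y * χ₂ (-((a : F) + y)) = χ₁ a * χ₂ a * K χ₁ χ₂ := by
  rw [K, Finset.mul_sum]
  symm
  refine Fintype.sum_equiv (Units.mulLeft a) _ _ fun x => ?_
  simp only [Units.mulLeft_apply]
  rw [show -((a : F) + a * x) = a * (-(1 + x)) by ring, map_mul, map_mul]
  ring

omit [Fintype F] [DecidableEq F] in
/-- `‖χ(-1)‖ = 1`. -/
theorem norm_apply_neg_one (χ : MulChar F ℂ) : ‖χ (-1 : F)‖ = 1 := by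
  have h : χ (-1 : F) * χ (-1) = 1 := by rw [← map_mul, neg_one_mul, neg_neg, map_one]
  have h2 : ‖χ (-1 : F)‖ * ‖χ (-1 : F)‖ = 1 := by rw [← norm_mul, h, norm_one]
  rcases mul_self_eq_one_iff.mp h2 with h3 | h3
  · exact h3
  · linarith [norm_nonneg (χ (-1 : F))]

omit [DecidableEq F] in
/-- Over `ℂ`, `J(χ⁻¹,φ⁻¹) = conj J(χ,φ)`. -/
theorem jacobiSum_inv_inv_eq_conj (χ φ : MulChar F ℂ) :
    jacobiSum χ⁻¹ φ⁻¹ = starRingEnd ℂ (jacobiSum χ φ) := by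
  simp only [jacobiSum, map_sum, map_mul, starRingEnd_apply, MulChar.star_apply']

omit [DecidableEq F] in
/-- `‖J(χ,φ)‖ = √q` when `χ, φ, χφ` are nontrivial. [Mathlib `jacobiSum_mul_jacobiSum_inv`] -/
theorem norm_jacobiSum_eq_sqrt {χ φ : MulChar F ℂ} (hχ : χ ≠ 1) (hφ : φ ≠ 1) (hχφ : χ * φ ≠ 1) :
    ‖jacobiSum χ φ‖ = Real.sqrt (Fintype.card F) := by
  have hch : ringChar ℂ ≠ ringChar F := by
    rw [ringChar.eq_zero]; exact (CharP.ringChar_ne_zero_of_finite F).symm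
  have h := jacobiSum_mul_jacobiSum_inv hch hχ hφ hχφ
  rw [jacobiSum_inv_inv_eq_conj, Complex.mul_conj'] at h
  have h' : ‖jacobiSum χ φ‖ ^ 2 = (Fintype.card F : ℝ) := by exact_mod_cast h
  rw [← h', Real.sqrt_sq (norm_nonneg _)]

omit [DecidableEq F] in
/-- `1 ≤ √q`. -/
theorem one_le_sqrt_card : (1 : ℝ) ≤ Real.sqrt (Fintype.card F) := by
  rw [show (1 : ℝ) = Real.sqrt 1 by simp]
  exact Real.sqrt_le_sqrt (by exact_mod_cast one_le_card)

omit [DecidableEq F] in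
/-- `‖J(χ₁,χ₂)‖ ≤ √q` off the principal pair. -/
theorem norm_jacobiSum_le {χ₁ χ₂ : MulChar F ℂ} (h : ¬ (χ₁ = 1 ∧ χ₂ = 1)) :
    ‖jacobiSum χ₁ χ₂‖ ≤ Real.sqrt (Fintype.card F) := by
  by_cases h1 : χ₁ = 1
  · have h2 : χ₂ ≠ 1 := fun h2 => h ⟨h1, h2⟩
    rw [h1, jacobiSum_one_nontrivial h2, norm_neg, norm_one]; exact one_le_sqrt_card
  by_cases h2 : χ₂ = 1
  · rw [h2, jacobiSum_comm, jacobiSum_one_nontrivial h1, norm_neg, norm_one]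
    exact one_le_sqrt_card
  by_cases h12 : χ₁ * χ₂ = 1
  · rw [eq_inv_of_mul_eq_one_right h12, jacobiSum_nontrivial_inv h1, norm_neg,
      norm_apply_neg_one]
    exact one_le_sqrt_card
  · exact (norm_jacobiSum_eq_sqrt h1 h2 h12).le

omit [DecidableEq F] in
/-- `‖K(χ₁,χ₂)‖ ≤ √q` off the principal pair. -/
theorem norm_K_le {χ₁ χ₂ : MulChar F ℂ} (h : ¬ (χ₁ = 1 ∧ χ₂ = 1)) :
    ‖K χ₁ χ₂‖ ≤ Real.sqrt (Fintype.card F) := by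
  rw [K_eq, norm_mul, norm_mul, norm_apply_neg_one, norm_apply_neg_one, one_mul, one_mul]
  exact norm_jacobiSum_le h

omit [DecidableEq F] in
/-- `K(1,1) = q - 2`. -/
theorem K_one_one : K (1 : MulChar F ℂ) 1 = (Fintype.card F : ℂ) - 2 := by
  rw [K_eq, jacobiSum_one_one, MulChar.one_apply isUnit_one.neg, one_mul, one_mul]

/-! ### 2. Dual orthogonality for `MulChar F ℂ`, indicator expansion, Parseval -/

section CharSums

variable [Fintype (MulChar F ℂ)]

/-- There are `q - 1` characters `MulChar F ℂ`. [Mathlib `MulChar.card_eq_card_units_of_hasEnoughRootsOfUnity`] -/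
theorem card_mulChar : Fintype.card (MulChar F ℂ) = Fintype.card F - 1 := by
  have h := MulChar.card_eq_card_units_of_hasEnoughRootsOfUnity F ℂ
  rwa [Nat.card_eq_fintype_card, Nat.card_eq_fintype_card, Fintype.card_units] at h

omit [DecidableEq F] in
/-- `Σ_χ χ(a) = 0` for `a ≠ 1`. [folklore; Mathlib pattern `DirichletCharacter.sum_characters_eq_zero`] -/
theorem sum_char_apply_of_ne_one {a : F} (ha : a ≠ 1) : ∑ χ : MulChar F ℂ, χ a = 0 := by
  obtain ⟨ψ, hψ⟩ := MulChar.exists_apply_ne_one_of_hasEnoughRootsOfUnity F ℂ ha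
  refine eq_zero_of_mul_eq_self_left hψ ?_
  simp only [Finset.mul_sum, ← MulChar.mul_apply]
  exact Fintype.sum_bijective _ (Group.mulLeft_bijective ψ) _ _ fun χ' ↦ rfl

/-- `Σ_χ χ(a) = (q-1)·[a = 1]`. [folklore] -/
theorem sum_char_apply (a : F) :
    ∑ χ : MulChar F ℂ, χ a = if a = 1 then ((Fintype.card F : ℂ) - 1) else 0 := by
  split_ifs with ha
  · subst ha
    simp only [map_one, sum_const, card_univ, card_mulChar, nsmul_eq_mul, mul_one,
      cast_card_sub_one]
  · exact sum_char_apply_of_ne_one ha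

/-- `Σ_χ χ(b⁻¹) χ(y) = (q-1)·[y = b]` for a unit `b`. [folklore] -/
theorem sum_char_inv_mul_apply (b : Fˣ) (y : F) :
    ∑ χ : MulChar F ℂ, χ ((b⁻¹ : Fˣ) : F) * χ y =
      if y = (b : F) then ((Fintype.card F : ℂ) - 1) else 0 := by
  simp_rw [← map_mul]
  rw [sum_char_apply]
  rcases eq_or_ne y (b : F) with h | h
  · rw [if_pos (Units.inv_mul_eq_one.mpr h.symm), if_pos h]
  · have h' : ((b⁻¹ : Fˣ) : F) * y ≠ 1 := fun h1 => h (Units.inv_mul_eq_one.mp h1).symm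
    rw [if_neg h', if_neg h]

/-- Indicator expansion: `Σ_χ conj(ft B χ)·χ(y) = (q-1)·Σ_{b∈B} [y = b]`. [folklore] -/
theorem sum_star_ft_mul_apply (B : Finset Fˣ) (y : F) :
    ∑ χ : MulChar F ℂ, starRingEnd ℂ (ft B χ) * χ y =
      ((Fintype.card F : ℂ) - 1) * ∑ b ∈ B, (if y = (b : F) then (1 : ℂ) else 0) := by
  simp_rw [star_ft, Finset.sum_mul]
  rw [Finset.sum_comm]
  simp_rw [sum_char_inv_mul_apply, Finset.mul_sum, mul_ite, mul_one, mul_zero]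

/-- Parseval: `Σ_χ ‖ft A χ‖² = (q-1)·|A|`. [folklore] -/
theorem sum_norm_ft_sq (A : Finset Fˣ) :
    ∑ χ : MulChar F ℂ, ‖ft A χ‖ ^ 2 = ((Fintype.card F : ℝ) - 1) * A.card := by
  have h : ∀ χ : MulChar F ℂ, ((‖ft A χ‖ ^ 2 : ℝ) : ℂ) =
      ∑ a ∈ A, ∑ a' ∈ A, χ ((a'⁻¹ : Fˣ) : F) * χ (a : F) := by
    intro χ
    rw [Complex.ofReal_pow, ← Complex.mul_conj', star_ft, ft, Finset.sum_mul_sum]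
    exact Finset.sum_congr rfl fun a _ => Finset.sum_congr rfl fun a' _ => mul_comm _ _
  have hC : ((∑ χ : MulChar F ℂ, ‖ft A χ‖ ^ 2 : ℝ) : ℂ) = ((Fintype.card F : ℂ) - 1) * A.card := by
    rw [Complex.ofReal_sum]
    simp_rw [h]
    rw [Finset.sum_comm]
    simp_rw [Finset.sum_comm (s := (Finset.univ : Finset (MulChar F ℂ))) (t := A),
      sum_char_inv_mul_apply, Units.val_inj, Finset.sum_ite_eq]
    rw [Finset.sum_congr rfl (fun a ha => if_pos ha), Finset.sum_const, nsmul_eq_mul, mul_comm]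
  exact_mod_cast hC

/-! ### 3. The expansion of the solution count and the main identity -/

omit [DecidableEq F] in
/-- Expanding both indicator transforms at a unit `a`: the `(χ₁,χ₂)` coefficient is `conj B̂(χ₁)·conj Ĉ(χ₂)·χ₁(a)χ₂(a)·K(χ₁,χ₂)`. -/
theorem expand_at (a : Fˣ) (B C : Finset Fˣ) :
    ∑ y : F, (∑ χ₁ : MulChar F ℂ, starRingEnd ℂ (ft B χ₁) * χ₁ y) *
        (∑ χ₂ : MulChar F ℂ, starRingEnd ℂ (ft C χ₂) * χ₂ (-((a : F) + y)))
      = ∑ χ₁ : MulChar F ℂ, ∑ χ₂ : MulChar F ℂ,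
          starRingEnd ℂ (ft B χ₁) * starRingEnd ℂ (ft C χ₂) * (χ₁ a * χ₂ a * K χ₁ χ₂) := by
  calc _ = ∑ y : F, ∑ χ₁ : MulChar F ℂ, ∑ χ₂ : MulChar F ℂ, starRingEnd ℂ (ft B χ₁) *
            starRingEnd ℂ (ft C χ₂) * (χ₁ y * χ₂ (-((a : F) + y))) := by
        refine Finset.sum_congr rfl fun y _ => ?_
        rw [Finset.sum_mul_sum]
        exact Finset.sum_congr rfl fun χ₁ _ => Finset.sum_congr rfl fun χ₂ _ => by ring
    _ = ∑ χ₁ : MulChar F ℂ, ∑ χ₂ : MulChar F ℂ, ∑ y : F, starRingEnd ℂ (ft B χ₁) *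
            starRingEnd ℂ (ft C χ₂) * (χ₁ y * χ₂ (-((a : F) + y))) := by
        rw [Finset.sum_comm]
        exact Finset.sum_congr rfl fun χ₁ _ => Finset.sum_comm
    _ = _ := by
        refine Finset.sum_congr rfl fun χ₁ _ => Finset.sum_congr rfl fun χ₂ _ => ?_
        rw [← Finset.mul_sum, inner_sum_eq]

/-- If `A × B × C` carries no solution of `a + b + c = 0`, the full character expansion vanishes:
`Σ_{χ₁,χ₂} conj B̂(χ₁) conj Ĉ(χ₂) Â(χ₁χ₂) K(χ₁,χ₂) = 0`. -/
theorem main_identity (A B C : Finset Fˣ)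
    (hfree : ∀ a ∈ A, ∀ b ∈ B, ∀ c ∈ C, (a : F) + b + c ≠ 0) :
    ∑ χ₁ : MulChar F ℂ, ∑ χ₂ : MulChar F ℂ,
      starRingEnd ℂ (ft B χ₁) * starRingEnd ℂ (ft C χ₂) * ft A (χ₁ * χ₂) * K χ₁ χ₂ = 0 := by
  have hA : ∀ a ∈ A, ∑ χ₁ : MulChar F ℂ, ∑ χ₂ : MulChar F ℂ,
      starRingEnd ℂ (ft B χ₁) * starRingEnd ℂ (ft C χ₂) * (χ₁ a * χ₂ a * K χ₁ χ₂) = 0 := by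
    intro a ha
    rw [← expand_at]
    simp_rw [sum_star_ft_mul_apply]
    refine Finset.sum_eq_zero fun y _ => ?_
    have h0 : (∑ b ∈ B, if y = (b : F) then (1 : ℂ) else 0) *
        (∑ c ∈ C, if -((a : F) + y) = (c : F) then (1 : ℂ) else 0) = 0 := by
      by_cases hy : ∃ b ∈ B, y = (b : F)
      · obtain ⟨b, hb, rfl⟩ := hy
        rw [Finset.sum_eq_zero (s := C), mul_zero]
        intro c hc
        rw [if_neg]
        intro h
        exact hfree a ha b hb c hc (by rw [← h]; ring)
      · push Not at hy
        rw [Finset.sum_eq_zero fun b hb => if_neg (hy b hb), zero_mul]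
    rw [mul_mul_mul_comm, h0, mul_zero]
  calc _ = ∑ χ₁ : MulChar F ℂ, ∑ χ₂ : MulChar F ℂ, ∑ a ∈ A,
          starRingEnd ℂ (ft B χ₁) * starRingEnd ℂ (ft C χ₂) * (χ₁ a * χ₂ a * K χ₁ χ₂) := by
        refine Finset.sum_congr rfl fun χ₁ _ => Finset.sum_congr rfl fun χ₂ _ => ?_
        simp only [ft, MulChar.mul_apply, Finset.mul_sum, Finset.sum_mul]
        exact Finset.sum_congr rfl fun a _ => by ring
    _ = ∑ χ₁ : MulChar F ℂ, ∑ a ∈ A, ∑ χ₂ : MulChar F ℂ,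
          starRingEnd ℂ (ft B χ₁) * starRingEnd ℂ (ft C χ₂) * (χ₁ a * χ₂ a * K χ₁ χ₂) :=
        Finset.sum_congr rfl fun χ₁ _ => Finset.sum_comm
    _ = ∑ a ∈ A, ∑ χ₁ : MulChar F ℂ, ∑ χ₂ : MulChar F ℂ,
          starRingEnd ℂ (ft B χ₁) * starRingEnd ℂ (ft C χ₂) * (χ₁ a * χ₂ a * K χ₁ χ₂) :=
        Finset.sum_comm
    _ = 0 := Finset.sum_eq_zero hA

omit [DecidableEq F] in
/-- The characters trivial on `H` number `[Fˣ : H]`: `#{χ : χ|_H = 1} · |H| = q - 1`.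
[Mathlib `MulChar.card_subgroupOrderIsoSubgroupMulChar`] -/
theorem card_annihilator_mul_card (H : Subgroup Fˣ)
    [DecidablePred fun χ : MulChar F ℂ => ∀ u ∈ H, χ (u : F) = 1] :
    (Finset.univ.filter (fun χ : MulChar F ℂ => ∀ u ∈ H, χ (u : F) = 1)).card * Nat.card H
      = Fintype.card F - 1 := by
  have h1 : (Finset.univ.filter (fun χ : MulChar F ℂ => ∀ u ∈ H, χ (u : F) = 1)).card
      = Nat.card ((MulChar.subgroupOrderIsoSubgroupMulChar F ℂ H).ofDual) := by
    rw [← Fintype.card_subtype, ← Nat.card_eq_fintype_card]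
    exact Nat.card_congr (Equiv.subtypeEquivRight fun χ =>
      (MulChar.mem_subgroupOrderIsoSubgroupMulChar_iff (H := H) (χ := χ)).symm)
  rw [h1, MulChar.card_subgroupOrderIsoSubgroupMulChar,
    ← Nat.card_eq_fintype_card (α := F), ← Nat.card_units (α := F),
    Subgroup.card_eq_card_quotient_mul_card_subgroup H]

end CharSums

end Summit.MatrixMultiplication.MatrixMultiplication.Theorems.Cyclotomic
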